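import Summits.BirchSwinnertonDyer.Rank1Residual.GaloisImage.KuriharaLowerBoundThreeOfKolyvaginProduct
import Summits.BirchSwinnertonDyer.Rank1Residual.GaloisImage.KolyvaginPrimeCyclicityTransfer
import HarnessLib

/-!
# (C20) at `p = 3` in Kim's ℕ-currency with the cyclicity flag in the RECORDS' currency and the
# exceptional set discharged — adapters (M) and (L) of R1-23 (team n1011, ROUTE-1 §29.2; seat p18)

HONEST FRAMING (cell `b2b-bsdres`, verbatim in every file): the goal of the cell is to DELETE the
COMBINATION-SHAPED residual classes of the Birch–Swinnerton-Dyer formula for ALL analytic-rank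
`≤ 1` elliptic curves over `ℚ` — assembled STRICTLY from published theorems — so that the
rank-`≤ 1` remainder becomes exactly the CONSTRUCTION-SHAPED classes, which are TYPED, NOT
attempted. This is not "finishing BSD". Team n1011 (N10/N11, additive `X4 ∧ p = 3`): research
route; the END THEOREM of sub-route (a′) modulo NAMED typed inputs carried as explicit hypotheses
(nothing asserted). No class theorem is claimed; nothing is booked; no mark moves.

## What and why

`Assembly.padicValRat_le_of_kolyvaginProduct` (p276707) takes the cyclicity flag at the primes of
`n` on the reduction `W.reductionAt v` of the LOCAL minimal model, and a binder `hnS` saying that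
the places of `n` avoid the exceptional set `S` of the `τ`-datum.  The cell's certificate records
(`Additive/X4ThreeKuriharaCertRecords*`, the `X4/KuriharaLowerHalfSocket` shape) speak of the
GLOBAL minimal model reduced mod `ℓ`:
`Nat.card {P : ((integralModelInt W).map (Int.castRingHom (ZMod ℓ))).toAffine.Point // 3 • P = 0} ≤ 3`.
n1011-p09's `KolyvaginPrime.natCard_torsionBy_reductionAt_le_of_card_torsion_le` (p276212,
Silverman VII.1.3(b) as an injective additive map) converts one into the other; this file does the
conversion once (adapter (M)), discharges `hnS` for every `S ⊆ {bad places} ∪ {places above 3}`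
(a Kolyvagin prime is good and `≠ 3`), and offers the level binder `∀ ℓ ∣ n, ℓ ∤ N` discharged
when the parametrisation level IS the conductor (adapter (L), by `IsKolyvaginPrime.not_dvd_conductorNorm`;
the arithmetic binder stays the statement of record, r1 §29.2 (b)).

* `Assembly.padicValRat_le_of_kolyvaginProduct_of_card_torsion_le` — (M) + `hnS` discharged;
* `Assembly.padicValRat_le_of_kolyvaginProduct_of_card_torsion_le_of_level_eq` — (L) as well.

References: C.-H. Kim, AJM 148 (2026) §1.2.2, Thm. 1.9 [Kim2022StructureSelmer]; R. Sakamoto,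
JTNB 36 (2024) §2 [Sakamoto2024]; J. H. Silverman, *AEC* VII.1.3(b) [SilvermanAEC2009].
-/

noncomputable section

open scoped Classical NumberField ContRepresentation
open Function Field NumberField IsDedekindDomain IsDedekindDomain.HeightOneSpectrum WeierstrassCurve
  Literature.NumberTheory.EllipticCurves Literature.NumberTheory.EllipticCurves.ModularForms
  Literature.NumberTheory.EllipticCurves.Rank1Residual
  Literature.NumberTheory.GaloisRepresentations
  Literature.NumberTheory.GaloisRepresentations.DiscreteGaloisModule Literature.NumberTheory.GaloisCohomology
  Rat.HeightOneSpectrum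

namespace Summit.BirchSwinnertonDyer.Rank1Residual.GaloisImage.Assembly

/-- **Adapter (M), prime by prime.**  For a place `v` with `N v ∣ n`: the cyclicity flag at the
prime divisors of `n` in the records' currency (`#(E₀ mod ℓ)(𝔽_ℓ)[p] ≤ p` on the global minimal model)
gives the flag on the reduction of the local minimal model, `#Ẽ_v(k_v)[p] ≤ p` (p09's injective
additive map `Ẽ_v(k_v) →+ (E₀ mod ℓ)(𝔽_ℓ)`). [cite: SilvermanAEC2009, Prop. VII.1.3(b), p. 186] -/
theorem natCard_torsionBy_reductionAt_le_of_dvd (W : WeierstrassCurve ℚ) [W.IsElliptic]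
    [W.IsGloballyMinimal] (p : ℕ) {n : ℕ}
    (hcyc : ∀ (ℓ : ℕ) [Fact ℓ.Prime], ℓ ∣ n →
      Nat.card {P : ((integralModelInt W).map (Int.castRingHom (ZMod ℓ))).toAffine.Point //
        p • P = 0} ≤ p)
    {v : HeightOneSpectrum (𝓞 ℚ)} (hv : Ideal.absNorm v.asIdeal ∣ n) :
    Nat.card (AddSubgroup.torsionBy (W.reductionAt v).toAffine.Point (p : ℕ)) ≤ p := by
  have hℓ : (Ideal.absNorm v.asIdeal).Prime := FSComp.prime_absNorm_rat v
  haveI : Fact (Ideal.absNorm v.asIdeal).Prime := ⟨hℓ⟩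
  exact KolyvaginPrime.natCard_torsionBy_reductionAt_le_of_card_torsion_le W p
    (primesEquiv_eq_of_natCast_mem hℓ (Ideal.absNorm_mem v.asIdeal)) (hcyc _ hv)

/-- **The places of a Kolyvagin product avoid `{bad} ∪ {v ∣ p}`**: for `n ∈ 𝒩_K` and `N v ∣ n`,
`E` has good reduction at `v` and `p ∉ v` (`ℓ ∤ pN_E`). [cite: Kim2022StructureSelmer, §1.2.2] -/
theorem hasGoodReductionAt_and_not_mem_of_kolyvaginProduct (W : WeierstrassCurve ℚ) [W.IsElliptic]
    [W.IsGloballyMinimal] (p : ℕ) [hp : Fact p.Prime] {K n : ℕ} (hn : Kato.IsKolyvaginProduct W p K n)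
    {v : HeightOneSpectrum (𝓞 ℚ)} (hv : Ideal.absNorm v.asIdeal ∣ n) :
    W.HasGoodReductionAt v ∧ (p : 𝓞 ℚ) ∉ v.asIdeal := by
  have hℓ : (Ideal.absNorm v.asIdeal).Prime := FSComp.prime_absNorm_rat v
  have hℓn : Ideal.absNorm v.asIdeal ∈ n.primeFactors := Nat.mem_primeFactors.mpr ⟨hℓ, hv, hn.ne_zero⟩
  have hK : Kato.IsKolyvaginPrime W p K (Ideal.absNorm v.asIdeal) := hn.2 _ hℓn
  haveI : Fact (Ideal.absNorm v.asIdeal).Prime := ⟨hℓ⟩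
  have hvℓ : (primesEquiv v : ℕ) = Ideal.absNorm v.asIdeal :=
    primesEquiv_eq_of_natCast_mem hℓ (Ideal.absNorm_mem v.asIdeal)
  have hgood : W.HasGoodReductionAtPrime (Ideal.absNorm v.asIdeal) := by
    by_contra h
    exact hK.not_dvd_conductorNorm ((W.dvd_conductorNorm_iff_not_hasGoodReductionAtPrime _).mpr h)
  refine ⟨(hasGoodReductionAtPrime_primesEquiv_iff_holds W v _ hvℓ).mp hgood, fun h => ?_⟩
  exact hK.ne (hvℓ.symm.trans (primesEquiv_eq_of_natCast_mem hp.out h))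

/-- **(C20) at `p = 3` in Kim's ℕ-currency — adapter (M) applied and `hnS` discharged.**  The
statement of `padicValRat_le_of_kolyvaginProduct` (p276707) with: the cyclicity flag at the primes
of `n` in the RECORDS' currency
`∀ ℓ prime, ℓ ∣ n → #{P ∈ (E₀ mod ℓ)(ℤ/ℓ) | 3P = 0} ≤ 3` (`E₀ = integralModelInt W`, the
`hcyc` of `X4/KuriharaLowerHalfSocket`), converted by
`KolyvaginPrime.natCard_torsionBy_reductionAt_le_of_card_torsion_le`; and the exceptional set `S` of
the `τ`-datum only required to lie inside `{bad places} ∪ {places above 3}` (every place of `n` is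
then off `S`, `hasGoodReductionAt_and_not_mem_of_kolyvaginProduct`).  Binder `hnN : ∀ ℓ ∣ n, ℓ ∤ N`
arithmetic (r1 §29.2 (b)).  (B6): on `t = 1` rows supply `D ⊆ 𝒫_{k+1+t}`, `D′ ⊆ 𝒫_{k′+1+t}`.
[cite: Kim2022StructureSelmer, Thm. 1.9 (6), §1.2.2 and §1.4.3] [cite: Sakamoto2024, §2 and Thm. 4.4]
[cite: SilvermanAEC2009, Prop. VII.1.3(b)] -/
theorem padicValRat_le_of_kolyvaginProduct_of_card_torsion_le
    (W : WeierstrassCurve ℚ) [W.IsElliptic] [W.IsGloballyMinimal] (t k : ℕ)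
    (D : KolyvaginDatum (W.torsionGaloisModule (((3 : ℕ) : ℤ) ^ k * ((3 : ℕ) : ℤ))))
    (v₃ : HeightOneSpectrum (𝓞 ℚ)) (hv₃ : ((3 : ℕ) : 𝓞 ℚ) ∈ v₃.asIdeal)
    -- the row
    (hadd : Addv W 3) (hc3 : ¬ 3 ∣ (W.baseChange ℚ_[3]).localTamagawaNumber ℤ_[3])
    (hsurj : W.HasSurjectiveModNGaloisRep ((3 : ℕ) : ℤ))
    (ht : Nat.card {Q : (W.baseChange ℚ_[3]).toAffine.Point // (3 : ℕ) • Q = 0} = 3 ^ t)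
    (hL : W.entireLFunction 1 ≠ 0) [Finite W.toAffine.Point] [Finite W.sha]
    {N : ℕ} [NeZero N] (P : ModularParametrizationData W N) (hcP : ¬ ((3 : ℕ) : ℤ) ∣ P.maninConstant)
    (hper : ∃ u : ℚ, ‖(u : ℚ_[3])‖ = 1 ∧ W.realPeriodRat = u * plusPeriod P.f)
    -- the shallow datum
    (hDT : D.transverse = cyclotomicTransverse _)
    (g : Finset (HeightOneSpectrum (𝓞 ℚ)) →
      galoisCohomology (W.torsionGaloisModule (((3 : ℕ) : ℤ) ^ k * ((3 : ℕ) : ℤ))) 1)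
    (hg : g ∈ D.kolyvaginSystems (propagatedSelmerStructure W 3 k))
    (hgen : ∀ κ ∈ D.kolyvaginSystems (propagatedSelmerStructure W 3 k), ∃ a : ℕ, κ = a • g)
    -- the deep inputs, at every depth `k′`
    (D' : ∀ k' : ℕ, KolyvaginDatum (W.torsionGaloisModule (((3 : ℕ) : ℤ) ^ k' * ((3 : ℕ) : ℤ))))
    (hDT' : ∀ k', (D' k').transverse = cyclotomicTransverse _)
    (hPP' : ∀ k', (D' k').primes ⊆ D.primes)
    (red : ∀ k' : ℕ, (W.torsionGaloisModule (((3 : ℕ) : ℤ) ^ k' * ((3 : ℕ) : ℤ))).toContRepresentation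
      →ⁱL (W.torsionGaloisModule (((3 : ℕ) : ℤ) ^ k * ((3 : ℕ) : ℤ))).toContRepresentation)
    (hred : ∀ k', ∀ x : geomTorsion W (((3 : ℕ) : ℤ) ^ k' * ((3 : ℕ) : ℤ)),
      ((red k' x : geomTorsion W (((3 : ℕ) : ℤ) ^ k * ((3 : ℕ) : ℤ))) : geomPoints W) =
        (((3 : ℕ) : ℤ) ^ (k' - k)) • (x : geomPoints W))
    (hdict : ∀ k', k ≤ k' → KatoKuriharaDictionaryThreeAt₂ W t k k' D (D' k') (red k') v₃)
    (g' : ∀ k' : ℕ, Finset (HeightOneSpectrum (𝓞 ℚ)) →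
      galoisCohomology (W.torsionGaloisModule (((3 : ℕ) : ℤ) ^ k' * ((3 : ℕ) : ℤ))) 1)
    (hg' : ∀ k', g' k' ∈ (D' k').kolyvaginSystems (propagatedSelmerStructure W 3 k'))
    (hgo' : ∀ k', addOrderOf (g' k') = 3 ^ (k' + 1))
    (hgen' : ∀ k', ∀ κ ∈ (D' k').kolyvaginSystems (propagatedSelmerStructure W 3 k'),
      ∃ a : ℕ, κ = a • g' k')
    (inv' : ∀ k' : ℕ, LocalInvariants ℚ (3 ^ (k' + 1))) (hperf' : ∀ k', (inv' k').IsPerfect)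
    (hsum' : ∀ k', (inv' k').SumLocalTermEqZero) (hcompl' : ∀ k', (inv' k').SelmerComplement)
    (hinj' : ∀ k', ∀ v : HeightOneSpectrum (𝓞 ℚ), Injective (inv' k' (Sum.inr v)))
    (hEP : ∀ v : HeightOneSpectrum (𝓞 ℚ), localEulerPoincareCharacteristic (v.adicCompletion ℚ))
    (T : ∀ k' : ℕ, Finset (HeightOneSpectrum (𝓞 ℚ))) (hv₃T : ∀ k', v₃ ∈ T k')
    (hT : ∀ k', ∀ v : HeightOneSpectrum (𝓞 ℚ), v ∉ T k' →
      (((3 ^ (k' + 1) : ℕ) : ℕ) : 𝓞 ℚ) ∉ v.asIdeal ∧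
        GaloisRep.IsUnramifiedAt v (W.torsionGaloisModule (((3 : ℕ) : ℤ) ^ k' * ((3 : ℕ) : ℤ))))
    (h𝓕T : ∀ k', (propagatedSelmerStructure W 3 k').IsUnramifiedOutside (finSupport (T k')))
    (h𝓚T : ∀ k', (W.kummerSelmerStructure (((3 : ℕ) : ℤ) ^ k' * ((3 : ℕ) : ℤ))).IsUnramifiedOutside
      (finSupport (T k')))
    (hfinT : ∀ k', Finite (geomTorsion W (((3 : ℕ) : ℤ) ^ k' * ((3 : ℕ) : ℤ))))
    (hfinS : ∀ k', Finite (W.kummerSelmerStructure (((3 : ℕ) : ℤ) ^ k' * ((3 : ℕ) : ℤ))).selmerGroup)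
    (hPS : ∀ q ∈ D.primes, q ∉ T k) (hPS' : ∀ k', ∀ q ∈ (D' k').primes, q ∉ T k')
    (hUT : ∀ q ∈ D.primes,
      Nat.card (unramifiedSubgroup (GaloisRep.toLocal q
        (W.torsionGaloisModule (((3 : ℕ) : ℤ) ^ k * ((3 : ℕ) : ℤ)))) 1) =
        Nat.card (D.transverse (Sum.inr q)))
    (hUT' : ∀ k', ∀ q ∈ (D' k').primes,
      Nat.card (unramifiedSubgroup (GaloisRep.toLocal q
        (W.torsionGaloisModule (((3 : ℕ) : ℤ) ^ k' * ((3 : ℕ) : ℤ)))) 1) =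
        Nat.card ((D' k').transverse (Sum.inr q)))
    (hR22D : ∀ d, D.IsLevel d →
      (Nat.card ((inv' k).dualSelmerStructure _
          (D.atLevel (propagatedSelmerStructure W 3 k) d)).selmerGroup ∣ 3 ^ (k + 1) →
        addOrderOf (g d) * Nat.card ((inv' k).dualSelmerStructure _
          (D.atLevel (propagatedSelmerStructure W 3 k) d)).selmerGroup = 3 ^ (k + 1)) ∧
      (3 ^ (k + 1) ∣ Nat.card ((inv' k).dualSelmerStructure _
          (D.atLevel (propagatedSelmerStructure W 3 k) d)).selmerGroup → g d = 0))
    (hR22' : ∀ k' d, (D' k').IsLevel d →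
      (Nat.card ((inv' k').dualSelmerStructure _
          ((D' k').atLevel (propagatedSelmerStructure W 3 k') d)).selmerGroup ∣ 3 ^ (k' + 1) →
        addOrderOf (g' k' d) * Nat.card ((inv' k').dualSelmerStructure _
          ((D' k').atLevel (propagatedSelmerStructure W 3 k') d)).selmerGroup = 3 ^ (k' + 1)) ∧
      (3 ^ (k' + 1) ∣ Nat.card ((inv' k').dualSelmerStructure _
          ((D' k').atLevel (propagatedSelmerStructure W 3 k') d)).selmerGroup → g' k' d = 0))
    -- the shallow datum is a `τ`-datum at level `3^{k+1}` with `S ⊆ {bad} ∪ {v ∣ 3}`, and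
    -- `ρ_{E,3^{k+1}}` is onto
    {S : Set (HeightOneSpectrum (𝓞 ℚ))}
    (hS : ∀ v ∈ S, ¬ W.HasGoodReductionAt v ∨ ((3 : ℕ) : 𝓞 ℚ) ∈ v.asIdeal)
    {τ : absoluteGaloisGroup ℚ}
    (hτμ : τ ∈ rootsOfUnityFixer ℚ (3 ^ (k + 1)))
    (hτq : Nonempty (cokerSubOne (W.torsionGaloisModule (((3 : ℕ) : ℤ) ^ k * ((3 : ℕ) : ℤ))) τ ≃+
      ZMod (3 ^ (k + 1))))
    (hDP : D.primes = frobeniusClassPrimes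
      (W.torsionGaloisModule (((3 : ℕ) : ℤ) ^ k * ((3 : ℕ) : ℤ))) S τ (3 ^ (k + 1)))
    (hsurjK : W.HasSurjectiveModNGaloisRep (((3 : ℕ) : ℤ) ^ k * ((3 : ℕ) : ℤ)))
    -- the certificate in Kim's currency, flag in the records' currency
    (n : ℕ) [NeZero n] (hn : Kato.IsKolyvaginProduct W 3 (k + 1) n)
    (hcyc : ∀ (ℓ : ℕ) [Fact ℓ.Prime], ℓ ∣ n →
      Nat.card {P : ((integralModelInt W).map (Int.castRingHom (ZMod ℓ))).toAffine.Point //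
        3 • P = 0} ≤ 3)
    (hnN : ∀ ℓ ∈ n.primeFactors, ¬ ℓ ∣ N) {j : ℕ} (htj : t + j ≤ k + 1)
    (ψ : (ℓ : ℕ) → (ZMod ℓ)ˣ →* Multiplicative (ZMod (3 ^ j)))
    (hψ : ∀ ℓ ∈ n.primeFactors, Function.Surjective (ψ ℓ))
    (hcert : kuriharaNumber P.f (3 ^ j) n ψ ≠ 0)
    (hv : ∀ d : ℕ, d ∣ n → 1 < d → d < n → ∀ [NeZero d], kuriharaNumber P.f (3 ^ j) d ψ = 0) :
    ∃ q : ℚ, W.entireLFunction 1 / (W.realPeriodRat : ℂ) = (q : ℂ) ∧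
      padicValRat 3 q ≤
        (padicValNat 3 (Nat.card (AddCommGroup.primaryComponent W.sha 3)) : ℤ) + ((j - 1 : ℕ) : ℤ) := by
  haveI : Fact (Nat.Prime 3) := ⟨Nat.prime_three⟩
  refine padicValRat_le_of_kolyvaginProduct W t k D v₃ hv₃ hadd hc3 hsurj ht hL P hcP hper hDT g hg
    hgen D' hDT' hPP' red hred hdict g' hg' hgo' hgen' inv' hperf' hsum' hcompl' hinj' hEP T hv₃T hT
    h𝓕T h𝓚T hfinT hfinS hPS hPS' hUT hUT' hR22D hR22' hτμ hτq hDP hsurjK n hn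
    (fun v hv => natCard_torsionBy_reductionAt_le_of_dvd W 3 hcyc hv)
    (fun v hv hvS => ?_) hnN htj ψ hψ hcert hv
  -- a place of `n` is good and prime to `3`, hence off `S`
  obtain ⟨hgood, h3⟩ := hasGoodReductionAt_and_not_mem_of_kolyvaginProduct W 3 hn hv
  rcases hS v hvS with hbad | h3v
  · exact hbad hgood
  · exact h3 h3v

/-- **Adapter (L) as well: the parametrisation at the conductor.**  When the level of the modular
parametrisation datum IS the conductor `N_E` (`hN`), the binder `∀ ℓ ∣ n, ℓ ∤ N` of
`padicValRat_le_of_kolyvaginProduct_of_card_torsion_le` is discharged by name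
(`Kato.IsKolyvaginPrime.not_dvd_conductorNorm`: a Kolyvagin prime does not divide `N_E`).  For a
datum at an abstract level carrying a newform the tree's named fact
`IsNewformOf.level_eq_conductorNorm` (Carayol) supplies `hN`; it is NOT used here.
[cite: Kim2022StructureSelmer, Thm. 1.9 (6) and §1.2.2] [cite: Sakamoto2024, §2 and Thm. 4.4] -/
theorem padicValRat_le_of_kolyvaginProduct_of_card_torsion_le_of_level_eq
    (W : WeierstrassCurve ℚ) [W.IsElliptic] [W.IsGloballyMinimal] (t k : ℕ)
    (D : KolyvaginDatum (W.torsionGaloisModule (((3 : ℕ) : ℤ) ^ k * ((3 : ℕ) : ℤ))))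
    (v₃ : HeightOneSpectrum (𝓞 ℚ)) (hv₃ : ((3 : ℕ) : 𝓞 ℚ) ∈ v₃.asIdeal)
    (hadd : Addv W 3) (hc3 : ¬ 3 ∣ (W.baseChange ℚ_[3]).localTamagawaNumber ℤ_[3])
    (hsurj : W.HasSurjectiveModNGaloisRep ((3 : ℕ) : ℤ))
    (ht : Nat.card {Q : (W.baseChange ℚ_[3]).toAffine.Point // (3 : ℕ) • Q = 0} = 3 ^ t)
    (hL : W.entireLFunction 1 ≠ 0) [Finite W.toAffine.Point] [Finite W.sha]
    {N : ℕ} [NeZero N] (hN : N = W.conductorNorm ℤ) (P : ModularParametrizationData W N)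
    (hcP : ¬ ((3 : ℕ) : ℤ) ∣ P.maninConstant)
    (hper : ∃ u : ℚ, ‖(u : ℚ_[3])‖ = 1 ∧ W.realPeriodRat = u * plusPeriod P.f)
    (hDT : D.transverse = cyclotomicTransverse _)
    (g : Finset (HeightOneSpectrum (𝓞 ℚ)) →
      galoisCohomology (W.torsionGaloisModule (((3 : ℕ) : ℤ) ^ k * ((3 : ℕ) : ℤ))) 1)
    (hg : g ∈ D.kolyvaginSystems (propagatedSelmerStructure W 3 k))
    (hgen : ∀ κ ∈ D.kolyvaginSystems (propagatedSelmerStructure W 3 k), ∃ a : ℕ, κ = a • g)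
    (D' : ∀ k' : ℕ, KolyvaginDatum (W.torsionGaloisModule (((3 : ℕ) : ℤ) ^ k' * ((3 : ℕ) : ℤ))))
    (hDT' : ∀ k', (D' k').transverse = cyclotomicTransverse _)
    (hPP' : ∀ k', (D' k').primes ⊆ D.primes)
    (red : ∀ k' : ℕ, (W.torsionGaloisModule (((3 : ℕ) : ℤ) ^ k' * ((3 : ℕ) : ℤ))).toContRepresentation
      →ⁱL (W.torsionGaloisModule (((3 : ℕ) : ℤ) ^ k * ((3 : ℕ) : ℤ))).toContRepresentation)
    (hred : ∀ k', ∀ x : geomTorsion W (((3 : ℕ) : ℤ) ^ k' * ((3 : ℕ) : ℤ)),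
      ((red k' x : geomTorsion W (((3 : ℕ) : ℤ) ^ k * ((3 : ℕ) : ℤ))) : geomPoints W) =
        (((3 : ℕ) : ℤ) ^ (k' - k)) • (x : geomPoints W))
    (hdict : ∀ k', k ≤ k' → KatoKuriharaDictionaryThreeAt₂ W t k k' D (D' k') (red k') v₃)
    (g' : ∀ k' : ℕ, Finset (HeightOneSpectrum (𝓞 ℚ)) →
      galoisCohomology (W.torsionGaloisModule (((3 : ℕ) : ℤ) ^ k' * ((3 : ℕ) : ℤ))) 1)
    (hg' : ∀ k', g' k' ∈ (D' k').kolyvaginSystems (propagatedSelmerStructure W 3 k'))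
    (hgo' : ∀ k', addOrderOf (g' k') = 3 ^ (k' + 1))
    (hgen' : ∀ k', ∀ κ ∈ (D' k').kolyvaginSystems (propagatedSelmerStructure W 3 k'),
      ∃ a : ℕ, κ = a • g' k')
    (inv' : ∀ k' : ℕ, LocalInvariants ℚ (3 ^ (k' + 1))) (hperf' : ∀ k', (inv' k').IsPerfect)
    (hsum' : ∀ k', (inv' k').SumLocalTermEqZero) (hcompl' : ∀ k', (inv' k').SelmerComplement)
    (hinj' : ∀ k', ∀ v : HeightOneSpectrum (𝓞 ℚ), Injective (inv' k' (Sum.inr v)))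
    (hEP : ∀ v : HeightOneSpectrum (𝓞 ℚ), localEulerPoincareCharacteristic (v.adicCompletion ℚ))
    (T : ∀ k' : ℕ, Finset (HeightOneSpectrum (𝓞 ℚ))) (hv₃T : ∀ k', v₃ ∈ T k')
    (hT : ∀ k', ∀ v : HeightOneSpectrum (𝓞 ℚ), v ∉ T k' →
      (((3 ^ (k' + 1) : ℕ) : ℕ) : 𝓞 ℚ) ∉ v.asIdeal ∧
        GaloisRep.IsUnramifiedAt v (W.torsionGaloisModule (((3 : ℕ) : ℤ) ^ k' * ((3 : ℕ) : ℤ))))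
    (h𝓕T : ∀ k', (propagatedSelmerStructure W 3 k').IsUnramifiedOutside (finSupport (T k')))
    (h𝓚T : ∀ k', (W.kummerSelmerStructure (((3 : ℕ) : ℤ) ^ k' * ((3 : ℕ) : ℤ))).IsUnramifiedOutside
      (finSupport (T k')))
    (hfinT : ∀ k', Finite (geomTorsion W (((3 : ℕ) : ℤ) ^ k' * ((3 : ℕ) : ℤ))))
    (hfinS : ∀ k', Finite (W.kummerSelmerStructure (((3 : ℕ) : ℤ) ^ k' * ((3 : ℕ) : ℤ))).selmerGroup)
    (hPS : ∀ q ∈ D.primes, q ∉ T k) (hPS' : ∀ k', ∀ q ∈ (D' k').primes, q ∉ T k')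
    (hUT : ∀ q ∈ D.primes,
      Nat.card (unramifiedSubgroup (GaloisRep.toLocal q
        (W.torsionGaloisModule (((3 : ℕ) : ℤ) ^ k * ((3 : ℕ) : ℤ)))) 1) =
        Nat.card (D.transverse (Sum.inr q)))
    (hUT' : ∀ k', ∀ q ∈ (D' k').primes,
      Nat.card (unramifiedSubgroup (GaloisRep.toLocal q
        (W.torsionGaloisModule (((3 : ℕ) : ℤ) ^ k' * ((3 : ℕ) : ℤ)))) 1) =
        Nat.card ((D' k').transverse (Sum.inr q)))
    (hR22D : ∀ d, D.IsLevel d →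
      (Nat.card ((inv' k).dualSelmerStructure _
          (D.atLevel (propagatedSelmerStructure W 3 k) d)).selmerGroup ∣ 3 ^ (k + 1) →
        addOrderOf (g d) * Nat.card ((inv' k).dualSelmerStructure _
          (D.atLevel (propagatedSelmerStructure W 3 k) d)).selmerGroup = 3 ^ (k + 1)) ∧
      (3 ^ (k + 1) ∣ Nat.card ((inv' k).dualSelmerStructure _
          (D.atLevel (propagatedSelmerStructure W 3 k) d)).selmerGroup → g d = 0))
    (hR22' : ∀ k' d, (D' k').IsLevel d →
      (Nat.card ((inv' k').dualSelmerStructure _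
          ((D' k').atLevel (propagatedSelmerStructure W 3 k') d)).selmerGroup ∣ 3 ^ (k' + 1) →
        addOrderOf (g' k' d) * Nat.card ((inv' k').dualSelmerStructure _
          ((D' k').atLevel (propagatedSelmerStructure W 3 k') d)).selmerGroup = 3 ^ (k' + 1)) ∧
      (3 ^ (k' + 1) ∣ Nat.card ((inv' k').dualSelmerStructure _
          ((D' k').atLevel (propagatedSelmerStructure W 3 k') d)).selmerGroup → g' k' d = 0))
    {S : Set (HeightOneSpectrum (𝓞 ℚ))}
    (hS : ∀ v ∈ S, ¬ W.HasGoodReductionAt v ∨ ((3 : ℕ) : 𝓞 ℚ) ∈ v.asIdeal)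
    {τ : absoluteGaloisGroup ℚ}
    (hτμ : τ ∈ rootsOfUnityFixer ℚ (3 ^ (k + 1)))
    (hτq : Nonempty (cokerSubOne (W.torsionGaloisModule (((3 : ℕ) : ℤ) ^ k * ((3 : ℕ) : ℤ))) τ ≃+
      ZMod (3 ^ (k + 1))))
    (hDP : D.primes = frobeniusClassPrimes
      (W.torsionGaloisModule (((3 : ℕ) : ℤ) ^ k * ((3 : ℕ) : ℤ))) S τ (3 ^ (k + 1)))
    (hsurjK : W.HasSurjectiveModNGaloisRep (((3 : ℕ) : ℤ) ^ k * ((3 : ℕ) : ℤ)))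
    (n : ℕ) [NeZero n] (hn : Kato.IsKolyvaginProduct W 3 (k + 1) n)
    (hcyc : ∀ (ℓ : ℕ) [Fact ℓ.Prime], ℓ ∣ n →
      Nat.card {P : ((integralModelInt W).map (Int.castRingHom (ZMod ℓ))).toAffine.Point //
        3 • P = 0} ≤ 3)
    {j : ℕ} (htj : t + j ≤ k + 1)
    (ψ : (ℓ : ℕ) → (ZMod ℓ)ˣ →* Multiplicative (ZMod (3 ^ j)))
    (hψ : ∀ ℓ ∈ n.primeFactors, Function.Surjective (ψ ℓ))
    (hcert : kuriharaNumber P.f (3 ^ j) n ψ ≠ 0)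
    (hv : ∀ d : ℕ, d ∣ n → 1 < d → d < n → ∀ [NeZero d], kuriharaNumber P.f (3 ^ j) d ψ = 0) :
    ∃ q : ℚ, W.entireLFunction 1 / (W.realPeriodRat : ℂ) = (q : ℂ) ∧
      padicValRat 3 q ≤
        (padicValNat 3 (Nat.card (AddCommGroup.primaryComponent W.sha 3)) : ℤ) + ((j - 1 : ℕ) : ℤ) :=
  padicValRat_le_of_kolyvaginProduct_of_card_torsion_le W t k D v₃ hv₃ hadd hc3 hsurj ht hL P hcP hper
    hDT g hg hgen D' hDT' hPP' red hred hdict g' hg' hgo' hgen' inv' hperf' hsum' hcompl' hinj' hEP T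
    hv₃T hT h𝓕T h𝓚T hfinT hfinS hPS hPS' hUT hUT' hR22D hR22' hS hτμ hτq hDP hsurjK n hn hcyc
    (fun ℓ hℓ hℓN => (hn.2 ℓ hℓ).not_dvd_conductorNorm (hN ▸ hℓN)) htj ψ hψ hcert hv

end Summit.BirchSwinnertonDyer.Rank1Residual.GaloisImage.Assembly

end
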